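import Literature.ModelTheory.ExponentialFields.ModelTheoryPreds
import Mathlib.Order.Interval.Set.Infinite
import Mathlib.Order.Bounds.Basic
import HarnessLib

/-!
# Finite unions of intervals: the order-theoretic toolkit behind o-minimality

Topic `Literature/ModelTheory/ExponentialFields` (o-minimality lives here by the topic map).  The
predicate `Literature.ModelTheory.ExponentialFields.IsFiniteUnionOfIntervals s`
(`ModelTheoryPreds.lean`; van den Dries, *Tame topology and o-minimal structures* (1998), Ch. 1,
(3.2)) says that a subset `s` of a linear order lies in the Boolean algebra generated by the open
rays.  This file proves, sorry-free and purely order-theoretically (no model theory), the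
elementary consequences that van den Dries, Ch. 1, (3.3) records as "almost immediate from the
definition of o-minimality" and that the monotonicity theorem (Ch. 3, (1.2)) uses "frequently
without explicit reference":

* `IsFiniteUnionOfIntervals.exists_finset_Ioo_subset_or_disjoint`: there is a finite set `F` of
  points such that `s` is *constant* (all in, or all out) on every open interval avoiding `F`
  (Ch. 1, (3.3)(ii): the boundary `bd(A)` is finite and `A` is constant between consecutive
  boundary points);
* `IsFiniteUnionOfIntervals.exists_Ioo_subset_or_disjoint_right` / `_left`: at every point `x`
  the set has a constant *germ* on the right and on the left (`(x, c) ⊆ s` or `(x, c) ∩ s = ∅` for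
  some `c > x`);
* `IsFiniteUnionOfIntervals.exists_Ioo_subset_of_infinite`: an infinite such set contains a
  non-trivial open interval (Ch. 1, (3.2)/(O2), the form in which o-minimality is used in Ch. 3,
  §1);
* `IsFiniteUnionOfIntervals.exists_isLUB` / `exists_isGLB`: a non-empty bounded such set has a
  least upper bound / greatest lower bound in `M` (Ch. 1, (3.3)(i): "Dedekind completeness for
  definable sets");
* `IsFiniteUnionOfIntervals.preimage_toDual` / `preimage_ofDual`: the notion is invariant under
  reversing the order (used to halve the work by duality).

Standing hypotheses as in van den Dries, Ch. 1, (3.1)–(3.2): a dense linear order without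
endpoints where density or the absence of endpoints matters (stated per lemma).  Nothing here is
a named fact.

## References

* [Dries1998] L. van den Dries, *Tame topology and o-minimal structures*, LMS Lecture Note Series
  248, CUP 1998, Ch. 1, (3.2)–(3.3); Ch. 3, (1.1)–(1.5).
* [PillaySteinhorn1986] A. Pillay, C. Steinhorn, *Definable sets in ordered structures I*, Trans.
  AMS 295 (1986) 565–592, §1.
-/

open Set

namespace Literature.ModelTheory.ExponentialFields

namespace IsFiniteUnionOfIntervals

variable {M : Type*} [LinearOrder M] {s : Set M}

/-! ### The finite exceptional set -/

/-- **Finite boundary** (van den Dries 1998, Ch. 1, (3.3)(ii)): a finite union of points and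
intervals `s` admits a finite set `F` such that every open interval `(a, b)` containing no point of
`F` is either contained in `s` or disjoint from `s`. (For a generator `(-∞, a)` or `(a, ∞)` take
`F = {a}`; the property is preserved by finite unions, with `F₁ ∪ F₂`, and by complements.)
[cite: Dries1998, Ch. 1 (3.3)(ii)] -/
theorem exists_finset_Ioo_subset_or_disjoint (hs : IsFiniteUnionOfIntervals s) :
    ∃ F : Finset M, ∀ a b : M, (∀ z ∈ F, z ∉ Ioo a b) →
      Ioo a b ⊆ s ∨ Disjoint (Ioo a b) s := by
  classical
  induction hs using BooleanSubalgebra.closure_bot_sup_induction with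
  | mem s hs =>
    rcases hs with ⟨a, rfl⟩ | ⟨a, rfl⟩
    · refine ⟨{a}, fun p q hpq => ?_⟩
      have ha : a ∉ Ioo p q := hpq a (Finset.mem_singleton_self a)
      by_cases hq : q ≤ a
      · exact Or.inl fun x hx => lt_of_lt_of_le hx.2 hq
      · have hap : a ≤ p := le_of_not_gt fun hpa => ha ⟨hpa, lt_of_not_ge hq⟩
        exact Or.inr (disjoint_left.2 fun x hx (hxa : x < a) => (not_lt.2 hap) (hx.1.trans hxa))
    · refine ⟨{a}, fun p q hpq => ?_⟩
      have ha : a ∉ Ioo p q := hpq a (Finset.mem_singleton_self a)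
      by_cases hp : a ≤ p
      · exact Or.inl fun x hx => lt_of_le_of_lt hp hx.1
      · have hqa : q ≤ a := le_of_not_gt fun haq => ha ⟨lt_of_not_ge hp, haq⟩
        exact Or.inr (disjoint_left.2 fun x hx (hax : a < x) => (not_lt.2 hqa) (hax.trans hx.2))
  | bot => exact ⟨∅, fun p q _ => Or.inr (disjoint_left.2 fun x _ hx => hx)⟩
  | sup s _ t _ ihs iht =>
    obtain ⟨F₁, h₁⟩ := ihs
    obtain ⟨F₂, h₂⟩ := iht
    refine ⟨F₁ ∪ F₂, fun p q hpq => ?_⟩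
    have hpq₁ : ∀ z ∈ F₁, z ∉ Ioo p q := fun z hz => hpq z (Finset.mem_union_left _ hz)
    have hpq₂ : ∀ z ∈ F₂, z ∉ Ioo p q := fun z hz => hpq z (Finset.mem_union_right _ hz)
    rcases h₁ p q hpq₁ with h | h
    · exact Or.inl (h.trans subset_union_left)
    · rcases h₂ p q hpq₂ with h' | h'
      · exact Or.inl (h'.trans subset_union_right)
      · exact Or.inr (disjoint_left.2 fun x hx hx' => hx'.elim (disjoint_left.1 h hx) (disjoint_left.1 h' hx))
  | compl s _ ih =>
    obtain ⟨F, hF⟩ := ih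
    refine ⟨F, fun p q hpq => ?_⟩
    rcases hF p q hpq with h | h
    · exact Or.inr (disjoint_left.2 fun x hx hx' => hx' (h hx))
    · exact Or.inl fun x hx hx' => disjoint_left.1 h hx hx'

/-! ### Intervals avoiding a finite set -/

omit [LinearOrder M] in
/-- Elementary: to the right of any point `x` there is an open interval `(x, c)` containing no
point of a given finite set (in a linear order without greatest element). [folklore] -/
theorem _root_.Literature.ModelTheory.ExponentialFields.exists_gt_forall_notMem_Ioo
    [LinearOrder M] [NoMaxOrder M] (F : Finset M) (x : M) :
    ∃ c, x < c ∧ ∀ z ∈ F, z ∉ Ioo x c := by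
  classical
  by_cases h : (F.filter fun z => x < z).Nonempty
  · refine ⟨(F.filter fun z => x < z).min' h, ?_, fun z hz hzI => ?_⟩
    · have hm := Finset.min'_mem _ h
      exact (Finset.mem_filter.1 hm).2
    · have hle : (F.filter fun z => x < z).min' h ≤ z :=
        Finset.min'_le _ _ (Finset.mem_filter.2 ⟨hz, hzI.1⟩)
      exact (not_lt.2 hle) hzI.2
  · obtain ⟨c, hc⟩ := exists_gt x
    refine ⟨c, hc, fun z hz hzI => h ⟨z, Finset.mem_filter.2 ⟨hz, hzI.1⟩⟩⟩

omit [LinearOrder M] in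
/-- Elementary: to the left of any point `x` there is an open interval `(c, x)` containing no
point of a given finite set (in a linear order without least element). [folklore] -/
theorem _root_.Literature.ModelTheory.ExponentialFields.exists_lt_forall_notMem_Ioo
    [LinearOrder M] [NoMinOrder M] (F : Finset M) (x : M) :
    ∃ c, c < x ∧ ∀ z ∈ F, z ∉ Ioo c x := by
  classical
  by_cases h : (F.filter fun z => z < x).Nonempty
  · refine ⟨(F.filter fun z => z < x).max' h, ?_, fun z hz hzI => ?_⟩
    · have hm := Finset.max'_mem _ h
      exact (Finset.mem_filter.1 hm).2
    · have hle : z ≤ (F.filter fun z => z < x).max' h :=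
        Finset.le_max' _ _ (Finset.mem_filter.2 ⟨hz, hzI.2⟩)
      exact (not_lt.2 hle) hzI.1
  · obtain ⟨c, hc⟩ := exists_lt x
    refine ⟨c, hc, fun z hz hzI => h ⟨z, Finset.mem_filter.2 ⟨hz, hzI.2⟩⟩⟩

omit [LinearOrder M] in
/-- Elementary: a point outside a finite set `F` lies in an open interval containing no point of
`F` (linear order without endpoints). [folklore] -/
theorem _root_.Literature.ModelTheory.ExponentialFields.exists_Ioo_forall_notMem_of_notMem
    [LinearOrder M] [NoMinOrder M] [NoMaxOrder M] (F : Finset M) {x : M} (hx : x ∉ F) :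
    ∃ a b, a < x ∧ x < b ∧ ∀ z ∈ F, z ∉ Ioo a b := by
  obtain ⟨a, hax, ha⟩ := exists_lt_forall_notMem_Ioo F x
  obtain ⟨b, hxb, hb⟩ := exists_gt_forall_notMem_Ioo F x
  refine ⟨a, b, hax, hxb, fun z hz hzI => ?_⟩
  rcases lt_trichotomy z x with h | rfl | h
  · exact ha z hz ⟨hzI.1, h⟩
  · exact hx hz
  · exact hb z hz ⟨h, hzI.2⟩

/-! ### Germs, intervals inside infinite sets -/

/-- **Right germs are constant** (van den Dries 1998, Ch. 1, (3.3)(ii); the form used throughout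
Ch. 3, §1: "one of the parts contains an interval `(c, x)`"): for every point `x` there is
`c > x` with `(x, c) ⊆ s` or `(x, c) ∩ s = ∅`. [cite: Dries1998, Ch. 1 (3.3)(ii)] -/
theorem exists_Ioo_subset_or_disjoint_right [NoMaxOrder M] (hs : IsFiniteUnionOfIntervals s)
    (x : M) : ∃ c, x < c ∧ (Ioo x c ⊆ s ∨ Disjoint (Ioo x c) s) := by
  obtain ⟨F, hF⟩ := hs.exists_finset_Ioo_subset_or_disjoint
  obtain ⟨c, hxc, hc⟩ := exists_gt_forall_notMem_Ioo F x
  exact ⟨c, hxc, hF x c hc⟩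

/-- **Left germs are constant** (van den Dries 1998, Ch. 1, (3.3)(ii)): for every point `x`
there is `c < x` with `(c, x) ⊆ s` or `(c, x) ∩ s = ∅`. [cite: Dries1998, Ch. 1 (3.3)(ii)] -/
theorem exists_Ioo_subset_or_disjoint_left [NoMinOrder M] (hs : IsFiniteUnionOfIntervals s)
    (x : M) : ∃ c, c < x ∧ (Ioo c x ⊆ s ∨ Disjoint (Ioo c x) s) := by
  obtain ⟨F, hF⟩ := hs.exists_finset_Ioo_subset_or_disjoint
  obtain ⟨c, hcx, hc⟩ := exists_lt_forall_notMem_Ioo F x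
  exact ⟨c, hcx, hF c x hc⟩

/-- Outside a finite exceptional set, every point of a finite union of intervals `s` has a whole
open neighbourhood `(a, b) ∋ x` inside `s` (van den Dries 1998, Ch. 1, (3.3)(ii)).
[cite: Dries1998, Ch. 1 (3.3)(ii)] -/
theorem exists_finset_forall_exists_Ioo_subset [NoMinOrder M] [NoMaxOrder M]
    (hs : IsFiniteUnionOfIntervals s) :
    ∃ F : Finset M, ∀ x ∈ s, x ∉ F → ∃ a b, a < x ∧ x < b ∧ Ioo a b ⊆ s := by
  obtain ⟨F, hF⟩ := hs.exists_finset_Ioo_subset_or_disjoint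
  refine ⟨F, fun x hxs hxF => ?_⟩
  obtain ⟨a, b, hax, hxb, hab⟩ := exists_Ioo_forall_notMem_of_notMem F hxF
  rcases hF a b hab with h | h
  · exact ⟨a, b, hax, hxb, h⟩
  · exact absurd hxs (disjoint_left.1 h ⟨hax, hxb⟩)

/-- **An infinite finite union of intervals contains an open interval** (van den Dries 1998,
Ch. 1, (3.2), (O2) — the way o-minimality enters every argument of Ch. 3, §1: "`(a, b) − X` must
be finite, since otherwise it would contain an interval"). [cite: Dries1998, Ch. 1 (3.2)] -/
theorem exists_Ioo_subset_of_infinite [NoMinOrder M] [NoMaxOrder M]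
    (hs : IsFiniteUnionOfIntervals s) (hinf : s.Infinite) :
    ∃ a b, a < b ∧ Ioo a b ⊆ s := by
  obtain ⟨F, hF⟩ := hs.exists_finset_forall_exists_Ioo_subset
  obtain ⟨x, hxs, hxF⟩ := (hinf.sdiff F.finite_toSet).nonempty
  obtain ⟨a, b, hax, hxb, h⟩ := hF x hxs hxF
  exact ⟨a, b, hax.trans hxb, h⟩

/-- Bookkeeping variant: if the infinite finite union of intervals `s` is contained in `t`, the
open interval found lies in `t` as well (van den Dries 1998, Ch. 1, (3.2)). [cite: Dries1998, Ch. 1 (3.2)] -/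
theorem exists_Ioo_subset_of_infinite_of_subset [NoMinOrder M] [NoMaxOrder M] {t : Set M}
    (hs : IsFiniteUnionOfIntervals s) (hinf : s.Infinite) (hst : s ⊆ t) :
    ∃ a b, a < b ∧ Ioo a b ⊆ s ∧ Ioo a b ⊆ t := by
  obtain ⟨a, b, hab, h⟩ := hs.exists_Ioo_subset_of_infinite hinf
  exact ⟨a, b, hab, h, h.trans hst⟩

/-! ### Dedekind completeness for finite unions of intervals -/

/-- **Dedekind completeness for definable sets** (van den Dries 1998, Ch. 1, (3.3)(i)): in a
dense linear order without endpoints, a non-empty finite union of points and intervals that is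
bounded above has a least upper bound *in `M`*. (The least point of the finite exceptional set
that bounds `s` from above is the supremum.) [cite: Dries1998, Ch. 1 (3.3)(i)] -/
theorem exists_isLUB [DenselyOrdered M] [NoMinOrder M] [NoMaxOrder M]
    (hs : IsFiniteUnionOfIntervals s) (hne : s.Nonempty) (hbdd : BddAbove s) :
    ∃ m, IsLUB s m := by
  classical
  obtain ⟨F, hF⟩ := hs.exists_finset_Ioo_subset_or_disjoint
  obtain ⟨x₀, hx₀⟩ := hne
  obtain ⟨u, hu⟩ := hbdd
  -- the points of `F` that bound `s` from above
  set F' := F.filter fun z => z ∈ upperBounds s with hF'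
  by_cases hF'ne : F'.Nonempty
  · set m := F'.min' hF'ne with hm
    have hmF' : m ∈ F' := Finset.min'_mem _ _
    have hmub : m ∈ upperBounds s := (Finset.mem_filter.1 hmF').2
    refine ⟨m, hmub, fun u' hu' => le_of_not_gt fun hu'm => ?_⟩
    -- `u'` is an upper bound of `s` below `m`: contradiction
    by_cases hms : m ∈ s
    · exact (not_le.2 hu'm) (hu' hms)
    have hlt : ∀ y ∈ s, y < m := fun y hy => lt_of_le_of_ne (hmub hy) fun h => hms (h ▸ hy)
    by_cases hG : (F.filter fun z => z < m).Nonempty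
    · -- `g`, the largest point of `F` below `m`: `(g, m)` avoids `F`
      set g := (F.filter fun z => z < m).max' hG with hg
      have hgmem := Finset.max'_mem _ hG
      have hgF : g ∈ F := (Finset.mem_filter.1 hgmem).1
      have hgm : g < m := (Finset.mem_filter.1 hgmem).2
      have hgavoid : ∀ z ∈ F, z ∉ Ioo g m := fun z hz hzI =>
        (not_lt.2 (Finset.le_max' _ z (Finset.mem_filter.2 ⟨hz, hzI.2⟩))) hzI.1
      rcases hF g m hgavoid with h | h
      · obtain ⟨y, hy₁, hy₂⟩ := exists_between (max_lt hgm hu'm)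
        have hys : y ∈ s := h ⟨lt_of_le_of_lt (le_max_left _ _) hy₁, hy₂⟩
        exact (not_le.2 (lt_of_le_of_lt (le_max_right _ _) hy₁)) (hu' hys)
      · have hgub : g ∈ upperBounds s := fun y hy =>
          le_of_not_gt fun hgy => disjoint_left.1 h ⟨hgy, hlt y hy⟩ hy
        exact (not_le.2 hgm) (Finset.min'_le _ _ (Finset.mem_filter.2 ⟨hgF, hgub⟩))
    · -- no point of `F` below `m`: `s` is constant on `(p, m)` for every `p < m`
      obtain ⟨p, hp⟩ := exists_lt x₀
      have hx₀m : x₀ < m := hlt x₀ hx₀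
      have havoid : ∀ z ∈ F, z ∉ Ioo p m := fun z hz hzI =>
        hG ⟨z, Finset.mem_filter.2 ⟨hz, hzI.2⟩⟩
      rcases hF p m havoid with h | h
      · obtain ⟨y, hy₁, hy₂⟩ := exists_between (max_lt (hp.trans hx₀m) hu'm)
        have hys : y ∈ s := h ⟨lt_of_le_of_lt (le_max_left _ _) hy₁, hy₂⟩
        exact (not_le.2 (lt_of_le_of_lt (le_max_right _ _) hy₁)) (hu' hys)
      · exact disjoint_left.1 h ⟨hp, hx₀m⟩ hx₀
  · -- no point of `F` bounds `s` from above: `s` reaches beyond `u`, contradiction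
    exfalso
    have hFlt : ∀ z ∈ F, z < u := fun z hz => by
      by_contra hzu
      have : z ∈ upperBounds s := fun y hy => (hu hy).trans (le_of_not_gt hzu)
      exact hF'ne ⟨z, Finset.mem_filter.2 ⟨hz, this⟩⟩
    obtain ⟨w, huw⟩ := exists_gt u
    by_cases hFne : F.Nonempty
    · set g := F.max' hFne with hg
      have hgF : g ∈ F := Finset.max'_mem _ _
      have hgu : g < u := hFlt g hgF
      have hgavoid : ∀ z ∈ F, z ∉ Ioo g w := fun z hz hzI =>
        (not_lt.2 (Finset.le_max' F z hz)) hzI.1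
      have hgnot : g ∉ upperBounds s := fun h => hF'ne ⟨g, Finset.mem_filter.2 ⟨hgF, h⟩⟩
      obtain ⟨y, hys, hgy⟩ : ∃ y ∈ s, g < y := by
        by_contra hcon
        exact hgnot fun y hy => le_of_not_gt fun hgy => hcon ⟨y, hy, hgy⟩
      rcases hF g w hgavoid with h | h
      · obtain ⟨y', hy'₁, hy'₂⟩ := exists_between huw
        exact (not_le.2 hy'₁) (hu (h ⟨hgu.trans hy'₁, hy'₂⟩))
      · exact disjoint_left.1 h ⟨hgy, (hu hys).trans_lt huw⟩ hys
    · have hFe : F = ∅ := Finset.not_nonempty_iff_eq_empty.1 hFne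
      obtain ⟨p, hp⟩ := exists_lt x₀
      have havoid : ∀ z ∈ F, z ∉ Ioo p w := fun z hz => by simp [hFe] at hz
      rcases hF p w havoid with h | h
      · obtain ⟨y', hy'₁, hy'₂⟩ := exists_between huw
        exact (not_le.2 hy'₁) (hu (h ⟨hp.trans ((hu hx₀).trans_lt hy'₁), hy'₂⟩))
      · exact disjoint_left.1 h ⟨hp, (hu hx₀).trans_lt huw⟩ hx₀

/-! ### Order reversal -/

/-- Reversing the order exchanges the two families of generating rays, so a subset of `Mᵒᵈ` is a
finite union of intervals iff the same subset of `M` is (bookkeeping for arguments "by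
symmetry", van den Dries 1998, Ch. 3, (1.4)–(1.5): "similarly", "completely similar").
[cite: Dries1998, Ch. 1 (3.2)] -/
theorem preimage_toDual {t : Set Mᵒᵈ} (ht : IsFiniteUnionOfIntervals t) :
    IsFiniteUnionOfIntervals (OrderDual.toDual ⁻¹' t : Set M) := by
  induction ht using BooleanSubalgebra.closure_bot_sup_induction with
  | mem t ht =>
    rcases ht with ⟨a, rfl⟩ | ⟨a, rfl⟩
    · have : (OrderDual.toDual ⁻¹' Iio a : Set M) = Ioi (OrderDual.ofDual a) :=
        Set.ext fun _ => Iff.rfl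
      rw [this]; exact isFiniteUnionOfIntervals_Ioi _
    · have : (OrderDual.toDual ⁻¹' Ioi a : Set M) = Iio (OrderDual.ofDual a) :=
        Set.ext fun _ => Iff.rfl
      rw [this]; exact isFiniteUnionOfIntervals_Iio _
  | bot => exact isFiniteUnionOfIntervals_empty
  | sup t _ t' _ ih ih' => exact ih.union ih'
  | compl t _ ih => exact ih.compl

/-- Reversing the order exchanges the two families of generating rays: a finite union of
intervals of `M`, viewed in `Mᵒᵈ`, is a finite union of intervals (van den Dries 1998, Ch. 1,
(3.2); bookkeeping for symmetric arguments). [cite: Dries1998, Ch. 1 (3.2)] -/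
theorem preimage_ofDual (hs : IsFiniteUnionOfIntervals s) :
    IsFiniteUnionOfIntervals (OrderDual.ofDual ⁻¹' s : Set Mᵒᵈ) := by
  induction hs using BooleanSubalgebra.closure_bot_sup_induction with
  | mem t ht =>
    rcases ht with ⟨a, rfl⟩ | ⟨a, rfl⟩
    · have : (OrderDual.ofDual ⁻¹' Iio a : Set Mᵒᵈ) = Ioi (OrderDual.toDual a) :=
        Set.ext fun _ => Iff.rfl
      rw [this]; exact isFiniteUnionOfIntervals_Ioi _
    · have : (OrderDual.ofDual ⁻¹' Ioi a : Set Mᵒᵈ) = Iio (OrderDual.toDual a) :=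
        Set.ext fun _ => Iff.rfl
      rw [this]; exact isFiniteUnionOfIntervals_Iio _
  | bot => exact isFiniteUnionOfIntervals_empty
  | sup t _ t' _ ih ih' => exact ih.union ih'
  | compl t _ ih => exact ih.compl

/-- **Dedekind completeness for definable sets, lower version** (van den Dries 1998, Ch. 1,
(3.3)(i)): a non-empty finite union of points and intervals that is bounded below has a greatest
lower bound in `M` (dense order without endpoints). [cite: Dries1998, Ch. 1 (3.3)(i)] -/
theorem exists_isGLB [DenselyOrdered M] [NoMinOrder M] [NoMaxOrder M]
    (hs : IsFiniteUnionOfIntervals s) (hne : s.Nonempty) (hbdd : BddBelow s) :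
    ∃ m, IsGLB s m := by
  obtain ⟨m, hm⟩ := hs.preimage_ofDual.exists_isLUB hne hbdd.dual
  exact ⟨OrderDual.ofDual m, hm.dual⟩

end IsFiniteUnionOfIntervals

end Literature.ModelTheory.ExponentialFields
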